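import Summits.Ventures.HSemireg.DualSieveSlotForms
import HarnessLib

/-!
# Venture HSemireg — S4-PUSH corner 2 (twisted sheaves ∕ complexes at `n = 6`), seat `gs-eng-2` (gen 25):
# KERNEL LEG for the KERNEL FACT of LEMMA SIX-EIGHT §4e (ii) — on `2`-forms, `ker(β ↦ β ∧ D̄′^{[2]}) = ⟨D̄′⟩`
# in characteristic `3` (and `= 0` otherwise); hence a kernel element of rank `≤ 2` vanishes
# (cell record: this seat's `general-structure/XCHECK-K0-gs2.md` §4e (ii) «MACHINE FACT (kerA.py)» + «PENCIL for the
# same fact, v1.3.1»; s4-ref g34's independent `kerA_check.py`; s4-search-2's S4-PR-51 (T6) THEOREM β)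

HONEST FRAMING. Count-neutral infrastructure: finite-dimensional exterior algebra over a field ONLY (the tree's
sign-free wedge model `Summit.Ventures.HSemireg.Wedge` of Mathlib's `ExteriorAlgebra` with Mathlib's monomial basis;
slot-form calculus from `DualSieveSlotForms`). NO definition is introduced; no variety, no sheaf, no `σ`, no census
count moves; nothing here says HC ∕ HC_CM ∕ HC_AV holds; no Literature fact is declared or used. NOT formalised: the
lattice-to-coordinates translation of §4e (that on `Λ′ = 3Λ_Y` of type `(1⁵, 2)` the reduction `D̄′` of `D′` is the
sum of the five regular slot forms, that the degree-`6` design condition reads `β̄ ∧ D̄′^{[2]} = 0`, and which integral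
forms carry the coefficients `e, Y, a, b, c` of §6) — pencil ×2 + machine, as recorded there.

WHAT IS FORMALISED. `I` a finite linear order, `S : Fin m → Finset I` pairwise disjoint `2`-slots with `m ≥ 4`
(generators outside the slots allowed), `h_i = E_{S i}`, `D = Σ h_i`, `Ω = Σ_{i<j} h_i ∧ h_j` (`2Ω = D ∧ D`,
`DualSieveSlotForms.D_mul_D`), `K` any field, `β ∈ ⋀²` (the degree-`2` span `Wedge.Hom K I univ 2`):
* `mul_Omega_eq_zero_iff` — if `3 = 0` in `K`: `β ∧ Ω = 0 ⟺ β = c • D` for some `c : K` (THE KERNEL IS THE LINE `K·D`);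
* `mul_Omega_eq_zero_iff_of_three_ne_zero` — if `3 ≠ 0` in `K`: `β ∧ Ω = 0 ⟺ β = 0`;
* `eq_zero_of_mul_self_eq_zero` — if `3 = 0`: `β ∧ β = 0` and `β ∧ Ω = 0` force `β = 0` (a decomposable `β = x ∧ y`
  squares to zero, `DualSieveSlotForms.ι_mul_ι_mul_self`; this is §4e (ii)'s «a kernel element of rank `≤ 2` is `0`:
  `β̄ = 0`, `B″ = 3B₁`»), because `β = cD` gives `β ∧ β = 2c²Ω` with `Ω ≠ 0`, `2 ≠ 0`;
* `degree_four_coeff` ∕ `degree_eight_coeff` (§6) — the integer bookkeeping of §4e (i) ∕ (iii) around the kernel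
  fact: degree `4` forces every Pfaffian coefficient of `B″^{[2]}` into `3ℤ` (so `B̄″ ∧ B̄″ = 2B̄″^{[2]} = 0` — the
  hypothesis of the corollary; the pencil's «rank `≤ 2`» detour is unnecessary), and with `B′ = 9B₁` the degree-`8`
  coefficient `81σ₄ + 243σ₃a + 729σ₂b + 6561σ₀c` on four regular slots has valuation exactly `6 < 7` (`omega`);
* `census_dim12_kernel`, `census_dim12_rank_two` — the CENSUS INSTANCE `K = 𝔽₃ = ZMod 3`, `I = Fin 12`, the five
  regular slots `{2k, 2k+1}` (`k < 5`) of `D̄′ = h̄₁ + … + h̄₅` (the sixth slot `{10, 11}` = the radical of `D̄′` carries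
  no slot form): «on `∧²𝔽₃¹²` the kernel of `β ↦ β ∧ D̄′^{[2]}` is one-dimensional, spanned by `D̄′`» (kerA.py: domain
  `66`, rank `65`, kernel `⟨D̄′⟩`).
PROOF = the pencil of XCHECK-K0 §4e (ii) v1.3.1, using only the UNIT-ness of the structure signs: STEP 1
(`coord_eq_zero_of_not_slot`) the coordinate of `β ∧ Ω` at `t₀ ⊔ S i₀ ⊔ S j₀` (`t₀` a non-slot pair, `i₀ < j₀` slots
disjoint from it — they exist since `m ≥ 4`) is `β_{t₀}` times a unit (unique decomposition), so `β_{t₀} = 0`;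
STEP 2 (`eq_sum_slots`) hence `β = Σ_k β_{S k} h_k`; STEP 3 (`triple_sum_eq_zero`, `triple_rel`) the coordinate of
`(Σ c_k h_k) ∧ Ω` at `S a ⊔ S b ⊔ S e` is `(c_a + c_b + c_e)` times ONE unit (the three surviving products
`h_a(h_b h_e) = h_b(h_a h_e) = h_e(h_a h_b)` coincide because slot forms are central), so `c_a + c_b + c_e = 0` for all
slot triples; STEP 4 (`coeff_eq`) with `m ≥ 4` two triples sharing two slots give `c_x = c_y` for all `x, y`, and then
`3c = 0` — automatic in characteristic `3` (where conversely `D ∧ Ω = 0` by `DualSieveSlotForms.D_mul_Omega`), forcing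
`c = 0` otherwise.
-/
open Module Finset

namespace Summit.Ventures.HSemireg.DualSieveDegreeSixKernel

open Summit.Ventures.HSemireg.Wedge Summit.Ventures.HSemireg.DualSieveSlotForms

variable (K : Type*) [Field K] {I : Type*} [LinearOrder I] [Fintype I] {m : ℕ} (S : Fin m → Finset I)

/-! ## §1 Non-slot pairs: their coefficients vanish on the kernel; reconstruction from the slots -/

/-- STEP 1. If `β ∧ Ω = 0`, the coordinate of `β` at every non-slot `2`-set `t₀` admitting two slots `i₀ < j₀`
disjoint from it vanishes: the coordinate of `β ∧ Ω` at `t₀ ⊔ S i₀ ⊔ S j₀` is `β_{t₀}` times a unit. -/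
lemma coord_eq_zero_of_not_slot (h2 : ∀ i, (S i).card = 2) (hd : Pairwise fun i j => Disjoint (S i) (S j))
    {β : HT K I} (hker : β * (∑ i, ∑ j, if i < j then B K I (S i) * B K I (S j) else 0) = 0)
    {t₀ : Finset I} (ht₀ : t₀.card = 2) (hgen : ∀ k, S k ≠ t₀) {i₀ j₀ : Fin m} (hlt₀ : i₀ < j₀)
    (hi₀ : Disjoint t₀ (S i₀)) (hj₀ : Disjoint t₀ (S j₀)) : (B K I).coord t₀ β = 0 := by
  classical
  rw [← (B K I).sum_repr β] at hker
  have h := congr_arg ((B K I).coord (t₀ ∪ (S i₀ ∪ S j₀))) hker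
  rw [map_zero, coord_sum_mul_sum] at h
  have hzero : ∀ (t : Finset I) (i j : Fin m), ¬ (t = t₀ ∧ i = i₀ ∧ j = j₀) →
      (if i < j ∧ t ∪ (S i ∪ S j) = t₀ ∪ (S i₀ ∪ S j₀)
        then (B K I).repr β t * (u K (S i) (S j) * u K t (S i ∪ S j)) else 0) = 0 := by
    intro t i j hne
    split_ifs with hc
    · by_cases hu : u K t (S i ∪ S j) = 0
      · rw [hu, mul_zero, mul_zero]
      · exact (hne (generic_unique S h2 hd ht₀ hgen hlt₀ hi₀ hj₀ hc.1 ((u_ne_zero_iff K).mp hu) hc.2)).elim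
    · rfl
  have hsum : (∑ t, ∑ i, ∑ j, if i < j ∧ t ∪ (S i ∪ S j) = t₀ ∪ (S i₀ ∪ S j₀)
      then (B K I).repr β t * (u K (S i) (S j) * u K t (S i ∪ S j)) else 0) =
      (B K I).repr β t₀ * (u K (S i₀) (S j₀) * u K t₀ (S i₀ ∪ S j₀)) := by
    rw [Finset.sum_eq_single_of_mem t₀ (Finset.mem_univ _) fun t _ ht =>
      Finset.sum_eq_zero fun i _ => Finset.sum_eq_zero fun j _ => hzero t i j fun h' => ht h'.1,
      sum_sum_eq_single _ i₀ j₀ fun i j hne => hzero t₀ i j fun h' => hne h'.2, if_pos ⟨hlt₀, rfl⟩]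
  rw [hsum] at h
  have hu1 : u K (S i₀) (S j₀) ≠ 0 := (u_ne_zero_iff K).mpr (hd hlt₀.ne)
  have hu2 : u K t₀ (S i₀ ∪ S j₀) ≠ 0 := (u_ne_zero_iff K).mpr (Finset.disjoint_union_right.mpr ⟨hi₀, hj₀⟩)
  rw [Basis.coord_apply]
  exact (mul_eq_zero.mp h).resolve_right (mul_ne_zero hu1 hu2)

/-- STEP 2. With at least four slots, a degree-`2` element `β` with `β ∧ Ω = 0` is a combination of the slot
forms: `β = Σ_k β_{S k} h_k`. -/
lemma eq_sum_slots (h2 : ∀ i, (S i).card = 2) (hd : Pairwise fun i j => Disjoint (S i) (S j)) (hm : 4 ≤ m)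
    {β : HT K I} (hβ : β ∈ Hom K I Finset.univ 2)
    (hker : β * (∑ i, ∑ j, if i < j then B K I (S i) * B K I (S j) else 0) = 0) :
    β = ∑ k, (B K I).coord (S k) β • B K I (S k) := by
  classical
  have hS : ∀ x ∈ (Finset.univ : Finset (Fin m)), ∀ y ∈ (Finset.univ : Finset (Fin m)), S x = S y → x = y :=
    fun x _ y _ h => slot_injective S h2 hd h
  simp only [Basis.coord_apply]
  calc β = ∑ t, (B K I).repr β t • B K I t := ((B K I).sum_repr β).symm
    _ = ∑ t ∈ Finset.univ.image S, (B K I).repr β t • B K I t := by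
        refine (Finset.sum_subset (Finset.subset_univ _) fun t _ ht => ?_).symm
        have hgen : ∀ k, S k ≠ t := fun k hk => ht (Finset.mem_image.mpr ⟨k, Finset.mem_univ _, hk⟩)
        suffices h0 : (B K I).coord t β = 0 by rw [Basis.coord_apply] at h0; rw [h0, zero_smul]
        by_cases htc : t.card = 2
        · obtain ⟨i₀, j₀, hlt, hi, hj⟩ := exists_disjoint_slots S hd hm htc.le
          exact coord_eq_zero_of_not_slot K S h2 hd hker htc hgen hlt hi hj
        · exact coord_eq_zero_of_mem_Hom K hβ fun h => htc h.2
    _ = ∑ k, (B K I).repr β (S k) • B K I (S k) := Finset.sum_image hS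

/-! ## §3 Slot triples: the coordinate of `(Σ c_k h_k) ∧ Ω` at `S a ⊔ S b ⊔ S e` is `(c_a + c_b + c_e) ·` unit -/

/-- STEP 3. If `(Σ_k c_k h_k) ∧ Ω = 0` then `c_a + c_b + c_e = 0` for all slots `a < b < e`. -/
lemma triple_sum_eq_zero (h2 : ∀ i, (S i).card = 2) (hd : Pairwise fun i j => Disjoint (S i) (S j))
    {c : Fin m → K} (hker : (∑ k, c k • B K I (S k)) *
      (∑ i, ∑ j, if i < j then B K I (S i) * B K I (S j) else 0) = 0)
    {a b e : Fin m} (hab : a < b) (hbe : b < e) : c a + c b + c e = 0 := by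
  classical
  have hae : a < e := hab.trans hbe
  have h := congr_arg ((B K I).coord (S a ∪ (S b ∪ S e))) hker
  rw [map_zero, coord_sum_mul_sum] at h
  -- which terms survive
  have hmem : ∀ x, S x ⊆ S a ∪ (S b ∪ S e) → x = a ∨ x = b ∨ x = e := by
    intro x hx
    have hx' : S x ⊆ ({a, b, e} : Finset (Fin m)).biUnion S := by
      simpa [Finset.biUnion_insert, Finset.singleton_biUnion] using hx
    simpa using mem_of_slot_subset_biUnion S h2 hd hx'
  have hzero : ∀ k i j : Fin m, ¬ ((k = a ∧ i = b ∧ j = e) ∨ (k = b ∧ i = a ∧ j = e) ∨ (k = e ∧ i = a ∧ j = b)) →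
      (if i < j ∧ S k ∪ (S i ∪ S j) = S a ∪ (S b ∪ S e)
        then c k * (u K (S i) (S j) * u K (S k) (S i ∪ S j)) else 0) = 0 := by
    intro k i j hne
    split_ifs with hc
    · by_cases hu : u K (S k) (S i ∪ S j) = 0
      · rw [hu, mul_zero, mul_zero]
      · exfalso
        have hdk : Disjoint (S k) (S i ∪ S j) := (u_ne_zero_iff K).mp hu
        have hki : k ≠ i := by
          rintro rfl
          exact (slot_nonempty S h2 k).ne_empty ((Finset.disjoint_self_iff_empty _).mp
            (Finset.disjoint_of_subset_right Finset.subset_union_left hdk))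
        have hkj : k ≠ j := by
          rintro rfl
          exact (slot_nonempty S h2 k).ne_empty ((Finset.disjoint_self_iff_empty _).mp
            (Finset.disjoint_of_subset_right Finset.subset_union_right hdk))
        have hkT : S k ⊆ S a ∪ (S b ∪ S e) := by rw [← hc.2]; exact Finset.subset_union_left
        have hiT : S i ⊆ S a ∪ (S b ∪ S e) := by
          rw [← hc.2]; exact Finset.subset_union_left.trans Finset.subset_union_right
        have hjT : S j ⊆ S a ∪ (S b ∪ S e) := by
          rw [← hc.2]; exact Finset.subset_union_right.trans Finset.subset_union_right
        have hk := hmem k hkT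
        have hi := hmem i hiT
        have hj := hmem j hjT
        have hij : (i : ℕ) < j := hc.1
        have hab' : (a : ℕ) < b := hab
        have hbe' : (b : ℕ) < e := hbe
        simp only [Fin.ext_iff] at hk hi hj hne hki hkj
        omega
    · rfl
  -- the three surviving units coincide
  have hUb : u K (S a) (S e) * u K (S b) (S a ∪ S e) = u K (S b) (S e) * u K (S a) (S b ∪ S e) := by
    have e1 : B K I (S b) * (B K I (S a) * B K I (S e)) = B K I (S a) * (B K I (S b) * B K I (S e)) := by
      rw [← mul_assoc, hslot_comm K S h2 b (S a), mul_assoc]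
    have := congr_arg ((B K I).coord (S a ∪ (S b ∪ S e))) e1
    rwa [coord_B_mul_B_mul_B, coord_B_mul_B_mul_B, if_pos (Finset.union_left_comm _ _ _), if_pos rfl] at this
  have hUe : u K (S a) (S b) * u K (S e) (S a ∪ S b) = u K (S b) (S e) * u K (S a) (S b ∪ S e) := by
    have e2 : B K I (S e) * (B K I (S a) * B K I (S b)) = B K I (S a) * (B K I (S b) * B K I (S e)) := by
      rw [← mul_assoc, hslot_comm K S h2 e (S a), mul_assoc, hslot_comm K S h2 e (S b)]
    have := congr_arg ((B K I).coord (S a ∪ (S b ∪ S e))) e2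
    rwa [coord_B_mul_B_mul_B, coord_B_mul_B_mul_B,
      if_pos (by rw [Finset.union_comm, Finset.union_assoc] : S e ∪ (S a ∪ S b) = S a ∪ (S b ∪ S e)),
      if_pos rfl] at this
  -- evaluate the sum
  have hsum : (∑ k, ∑ i, ∑ j, if i < j ∧ S k ∪ (S i ∪ S j) = S a ∪ (S b ∪ S e)
      then c k * (u K (S i) (S j) * u K (S k) (S i ∪ S j)) else 0) =
      c a * (u K (S b) (S e) * u K (S a) (S b ∪ S e)) + c b * (u K (S a) (S e) * u K (S b) (S a ∪ S e)) +
        c e * (u K (S a) (S b) * u K (S e) (S a ∪ S b)) := by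
    rw [sum_eq_three _ hab.ne hae.ne hbe.ne fun k hka hkb hke => Finset.sum_eq_zero fun i _ =>
      Finset.sum_eq_zero fun j _ => hzero k i j (by rintro (h' | h' | h'); exacts [hka h'.1, hkb h'.1, hke h'.1])]
    rw [sum_sum_eq_single _ b e fun i j hne => hzero a i j
        (by rintro (h' | h' | h'); exacts [hne h'.2, hab.ne h'.1, hae.ne h'.1]),
      sum_sum_eq_single _ a e fun i j hne => hzero b i j
        (by rintro (h' | h' | h'); exacts [hab.ne h'.1.symm, hne h'.2, hbe.ne h'.1]),
      sum_sum_eq_single _ a b fun i j hne => hzero e i j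
        (by rintro (h' | h' | h'); exacts [hae.ne h'.1.symm, hbe.ne h'.1.symm, hne h'.2]),
      if_pos ⟨hbe, rfl⟩, if_pos ⟨hae, Finset.union_left_comm _ _ _⟩,
      if_pos ⟨hab, by rw [Finset.union_comm, Finset.union_assoc]⟩]
  rw [hsum, hUb, hUe] at h
  have hU : u K (S b) (S e) * u K (S a) (S b ∪ S e) ≠ 0 :=
    mul_ne_zero ((u_ne_zero_iff K).mpr (hd hbe.ne))
      ((u_ne_zero_iff K).mpr (Finset.disjoint_union_right.mpr ⟨hd hab.ne, hd hae.ne⟩))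
  have h' : (c a + c b + c e) * (u K (S b) (S e) * u K (S a) (S b ∪ S e)) = 0 := by rw [← h]; ring
  exact (mul_eq_zero.mp h').resolve_right hU

/-- STEP 3 for any three distinct slots (sorting). -/
lemma triple_rel (h2 : ∀ i, (S i).card = 2) (hd : Pairwise fun i j => Disjoint (S i) (S j))
    {c : Fin m → K} (hker : (∑ k, c k • B K I (S k)) *
      (∑ i, ∑ j, if i < j then B K I (S i) * B K I (S j) else 0) = 0)
    {x y z : Fin m} (hxy : x ≠ y) (hxz : x ≠ z) (hyz : y ≠ z) : c x + c y + c z = 0 := by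
  have T : ∀ {a b e : Fin m}, a < b → b < e → c a + c b + c e = 0 :=
    fun hab hbe => triple_sum_eq_zero K S h2 hd hker hab hbe
  rcases lt_or_gt_of_ne hxy with hxy | hxy <;> rcases lt_or_gt_of_ne hxz with hxz | hxz <;>
    rcases lt_or_gt_of_ne hyz with hyz | hyz
  · exact T hxy hyz
  · linear_combination T hxz hyz
  · exact absurd (hxz.trans (hxy.trans hyz)) (lt_irrefl _)
  · linear_combination T hxz hxy
  · linear_combination T hxy hxz
  · exact absurd (hxy.trans (hxz.trans hyz)) (lt_irrefl _)
  · linear_combination T hyz hxz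
  · linear_combination T hyz hxy

/-- STEP 4. With at least four slots all coefficients of a kernel combination `Σ c_k h_k` are equal. -/
lemma coeff_eq (h2 : ∀ i, (S i).card = 2) (hd : Pairwise fun i j => Disjoint (S i) (S j)) (hm : 4 ≤ m)
    {c : Fin m → K} (hker : (∑ k, c k • B K I (S k)) *
      (∑ i, ∑ j, if i < j then B K I (S i) * B K I (S j) else 0) = 0)
    (x y : Fin m) : c x = c y := by
  classical
  by_cases hxy : x = y
  · rw [hxy]
  obtain ⟨p, hp, q, hq, hpq⟩ := Finset.one_lt_card.mp
    (show 1 < ((Finset.univ : Finset (Fin m)) \ {x, y}).card by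
      rw [Finset.card_sdiff_of_subset (Finset.subset_univ _), Finset.card_univ, Fintype.card_fin,
        Finset.card_pair hxy]; omega)
  simp only [Finset.mem_sdiff, Finset.mem_univ, Finset.mem_insert, Finset.mem_singleton, true_and,
    not_or] at hp hq
  have h1 := triple_rel K S h2 hd hker (Ne.symm hp.1) (Ne.symm hq.1) hpq
  have h2' := triple_rel K S h2 hd hker (Ne.symm hp.2) (Ne.symm hq.2) hpq
  linear_combination h1 - h2'

/-! ## §4 The kernel theorems -/

/-- KERNEL FACT, characteristic `3` (XCHECK-K0-gs2 §4e (ii); S4-PR-51 (T6)): for `m ≥ 4` pairwise disjoint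
`2`-slots in a finite linear order `I` and a field `K` with `3 = 0`, a degree-`2` element `β ∈ ⋀²` satisfies
`β ∧ Ω = 0` (`Ω = Σ_{i<j} h_i ∧ h_j = D^{[2]}`) iff `β` is a multiple of `D = Σ h_i`. -/
theorem mul_Omega_eq_zero_iff (h2 : ∀ i, (S i).card = 2) (hd : Pairwise fun i j => Disjoint (S i) (S j))
    (hm : 4 ≤ m) (h3 : (3 : K) = 0) {β : HT K I} (hβ : β ∈ Hom K I Finset.univ 2) :
    β * (∑ i, ∑ j, if i < j then B K I (S i) * B K I (S j) else 0) = 0 ↔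
      ∃ c : K, β = c • ∑ i, B K I (S i) := by
  constructor
  · intro hker
    have hβ' := eq_sum_slots K S h2 hd hm hβ hker
    have hker' : (∑ k, (B K I).coord (S k) β • B K I (S k)) *
        (∑ i, ∑ j, if i < j then B K I (S i) * B K I (S j) else 0) = 0 := by rw [← hβ']; exact hker
    refine ⟨(B K I).coord (S ⟨0, by omega⟩) β, ?_⟩
    conv_lhs => rw [hβ']
    rw [Finset.smul_sum]
    exact Finset.sum_congr rfl fun k _ => by rw [coeff_eq K S h2 hd hm hker' k ⟨0, by omega⟩]
  · rintro ⟨c, rfl⟩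
    rw [smul_mul_assoc, D_mul_Omega K S h2 h3, smul_zero]

/-- KERNEL FACT, characteristic `≠ 3`: under the same hypotheses with `3 ≠ 0` in `K`, `β ∧ Ω = 0` iff `β = 0`
(the triple relations force `3c = 0` for the common coefficient `c`). -/
theorem mul_Omega_eq_zero_iff_of_three_ne_zero (h2 : ∀ i, (S i).card = 2)
    (hd : Pairwise fun i j => Disjoint (S i) (S j)) (hm : 4 ≤ m) (h3 : (3 : K) ≠ 0) {β : HT K I}
    (hβ : β ∈ Hom K I Finset.univ 2) :
    β * (∑ i, ∑ j, if i < j then B K I (S i) * B K I (S j) else 0) = 0 ↔ β = 0 := by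
  constructor
  · intro hker
    have hβ' := eq_sum_slots K S h2 hd hm hβ hker
    have hker' : (∑ k, (B K I).coord (S k) β • B K I (S k)) *
        (∑ i, ∑ j, if i < j then B K I (S i) * B K I (S j) else 0) = 0 := by rw [← hβ']; exact hker
    have hrel := triple_rel K S h2 hd hker' (x := ⟨0, by omega⟩) (y := ⟨1, by omega⟩) (z := ⟨2, by omega⟩)
      (by simp) (by simp) (by simp)
    rw [coeff_eq K S h2 hd hm hker' ⟨1, by omega⟩ ⟨0, by omega⟩,
      coeff_eq K S h2 hd hm hker' ⟨2, by omega⟩ ⟨0, by omega⟩] at hrel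
    have h3c : (3 : K) * (B K I).coord (S ⟨0, by omega⟩) β = 0 := by rw [← hrel]; ring
    have hc0 := (mul_eq_zero.mp h3c).resolve_left h3
    rw [hβ']
    exact Finset.sum_eq_zero fun k _ => by rw [coeff_eq K S h2 hd hm hker' k ⟨0, by omega⟩, hc0, zero_smul]
  · rintro rfl
    exact zero_mul _

/-- COROLLARY (the use in LEMMA SIX-EIGHT §4e (ii): «a kernel element of rank `≤ 2` is `0`»): in characteristic
`3`, a degree-`2` element with `β ∧ β = 0` (e.g. a decomposable `β = x ∧ y`) and `β ∧ Ω = 0` vanishes —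
`β = c D` with `β ∧ β = 2c² Ω`, and `Ω ≠ 0`. -/
theorem eq_zero_of_mul_self_eq_zero (h2 : ∀ i, (S i).card = 2) (hd : Pairwise fun i j => Disjoint (S i) (S j))
    (hm : 4 ≤ m) (h3 : (3 : K) = 0) {β : HT K I} (hβ : β ∈ Hom K I Finset.univ 2) (hsq : β * β = 0)
    (hker : β * (∑ i, ∑ j, if i < j then B K I (S i) * B K I (S j) else 0) = 0) : β = 0 := by
  obtain ⟨c, rfl⟩ := (mul_Omega_eq_zero_iff K S h2 hd hm h3 hβ).mp hker
  rw [smul_mul_assoc, mul_smul_comm, smul_smul, D_mul_D K S h2, smul_smul, smul_eq_zero] at hsq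
  rcases hsq with h | h
  · rcases mul_eq_zero.mp h with h' | h'
    · rw [mul_self_eq_zero.mp h', zero_smul]
    · exact absurd h' (two_ne_zero_of_three K h3)
  · exact absurd h (Omega_ne_zero K S h2 hd (i₀ := ⟨0, by omega⟩) (j₀ := ⟨1, by omega⟩)
      (Fin.mk_lt_mk.mpr Nat.zero_lt_one))

/-! ## §5 The census instance: dimension `12`, `𝔽₃`, regular slots `{0,1}, {2,3}, {4,5}, {6,7}, {8,9}` -/

/-- CENSUS INSTANCE (XCHECK-K0-gs2 §4e (ii), kerA.py ∕ s4-ref's kerA_check.py: «on `∧²𝔽₃¹²` the kernel of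
`β ↦ β ∧ D̄′^{[2]}`, `D̄′ = h̄₁ + … + h̄₅`, is one-dimensional, spanned by `D̄′`»): with the five regular slots
`{2k, 2k+1}` (`k < 5`) of `Fin 12` over `ZMod 3` (the sixth slot `{10, 11}` is the radical of `D̄′` and carries
no slot form), a degree-`2` element `β` has `β ∧ Ω = 0` iff `β ∈ 𝔽₃ · D̄′`. -/
theorem census_dim12_kernel (β : HT (ZMod 3) (Fin 12)) (hβ : β ∈ Hom (ZMod 3) (Fin 12) Finset.univ 2) :
    β * (∑ i : Fin 5, ∑ j : Fin 5, if i < j then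
        B (ZMod 3) (Fin 12) {⟨2 * (i : ℕ), by omega⟩, ⟨2 * (i : ℕ) + 1, by omega⟩} *
          B (ZMod 3) (Fin 12) {⟨2 * (j : ℕ), by omega⟩, ⟨2 * (j : ℕ) + 1, by omega⟩} else 0) = 0 ↔
      ∃ c : ZMod 3, β = c • ∑ i : Fin 5, B (ZMod 3) (Fin 12) {⟨2 * (i : ℕ), by omega⟩, ⟨2 * (i : ℕ) + 1, by omega⟩} := by
  have h2 : ∀ i : Fin 5, Finset.card ({⟨2 * (i : ℕ), by omega⟩, ⟨2 * (i : ℕ) + 1, by omega⟩} : Finset (Fin 12)) = 2 :=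
    fun i => Finset.card_pair (by simp [Fin.ext_iff])
  have hd : Pairwise fun i j : Fin 5 => Disjoint ({⟨2 * (i : ℕ), by omega⟩, ⟨2 * (i : ℕ) + 1, by omega⟩} : Finset (Fin 12))
      ({⟨2 * (j : ℕ), by omega⟩, ⟨2 * (j : ℕ) + 1, by omega⟩} : Finset (Fin 12)) := by
    intro i j hij
    rw [Ne, Fin.ext_iff] at hij
    simp only [Finset.disjoint_insert_right, Finset.disjoint_singleton_right, Finset.mem_insert,
      Finset.mem_singleton, Fin.ext_iff]
    omega
  have key := mul_Omega_eq_zero_iff (ZMod 3)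
    (fun i : Fin 5 => ({⟨2 * (i : ℕ), by omega⟩, ⟨2 * (i : ℕ) + 1, by omega⟩} : Finset (Fin 12)))
    h2 hd (by norm_num) (by decide) hβ
  exact key

/-- CENSUS INSTANCE, the decomposable case of LEMMA SIX-EIGHT §4e (ii): over `𝔽₃` in dimension `12`, a
degree-`2` element `β̄` with `β̄ ∧ β̄ = 0` (rank `≤ 2`) and `β̄ ∧ D̄′^{[2]} = 0` is `0`. -/
theorem census_dim12_rank_two (β : HT (ZMod 3) (Fin 12)) (hβ : β ∈ Hom (ZMod 3) (Fin 12) Finset.univ 2)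
    (hsq : β * β = 0)
    (hker : β * (∑ i : Fin 5, ∑ j : Fin 5, if i < j then
        B (ZMod 3) (Fin 12) {⟨2 * (i : ℕ), by omega⟩, ⟨2 * (i : ℕ) + 1, by omega⟩} *
          B (ZMod 3) (Fin 12) {⟨2 * (j : ℕ), by omega⟩, ⟨2 * (j : ℕ) + 1, by omega⟩} else 0) = 0) : β = 0 := by
  have h2 : ∀ i : Fin 5, Finset.card ({⟨2 * (i : ℕ), by omega⟩, ⟨2 * (i : ℕ) + 1, by omega⟩} : Finset (Fin 12)) = 2 :=
    fun i => Finset.card_pair (by simp [Fin.ext_iff])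
  have hd : Pairwise fun i j : Fin 5 => Disjoint ({⟨2 * (i : ℕ), by omega⟩, ⟨2 * (i : ℕ) + 1, by omega⟩} : Finset (Fin 12))
      ({⟨2 * (j : ℕ), by omega⟩, ⟨2 * (j : ℕ) + 1, by omega⟩} : Finset (Fin 12)) := by
    intro i j hij
    rw [Ne, Fin.ext_iff] at hij
    simp only [Finset.disjoint_insert_right, Finset.disjoint_singleton_right, Finset.mem_insert,
      Finset.mem_singleton, Fin.ext_iff]
    omega
  have key := eq_zero_of_mul_self_eq_zero (ZMod 3)
    (fun i : Fin 5 => ({⟨2 * (i : ℕ), by omega⟩, ⟨2 * (i : ℕ) + 1, by omega⟩} : Finset (Fin 12)))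
    h2 hd (by norm_num) (by decide) hβ hsq
  exact key hker

/-! ## §6 The valuation bookkeeping of LEMMA SIX-EIGHT §4e (i) ∕ (iii) around the kernel fact (integers) -/

/-- §4e (i), DEGREE `4` (`v₃(σ₂) = 1`, `σ₀` a unit, `B′ = 3B″`, `D = 3D′` on `Λ′`): a coefficient of
`σ₂ D^{[2]} + 9σ₀ B″^{[2]} ∈ 3³ ∧⁴Λ′^∨` reads `27 ∣ σ₂·e + 9·σ₀·Y` with `27 ∣ σ₂·e` (`e ∈ 9ℤ` a coefficient of
`D^{[2]} = 9D′^{[2]}`, `3 ∣ σ₂`), hence `3 ∣ Y`: EVERY Pfaffian coefficient `Y` of `B″^{[2]}` vanishes mod `3` — so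
`B̄″ ∧ B̄″ = 2 B̄″^{[2]} = 0` over `𝔽₃` (cf. `DividedSquareLemma.sq_eq_two_mul_pfaffian_smul`), which is exactly the
hypothesis `β ∧ β = 0` of `eq_zero_of_mul_self_eq_zero` (the pencil's detour «rank `B̄″ ≤ 2`, `B̄″ = x̄ ∧ ȳ`» is not
needed for (ii)). -/
theorem degree_four_coeff {σ₀ σ₂ e Y : ℤ} (h : 27 ∣ σ₂ * e + 9 * (σ₀ * Y)) (he : 27 ∣ σ₂ * e)
    (hs : ¬ 3 ∣ σ₀) : 3 ∣ Y := by
  have h9 : 3 ∣ σ₀ * Y := by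
    generalize σ₂ * e = A at h he
    generalize σ₀ * Y = W at h ⊢
    omega
  exact (Int.prime_three.dvd_or_dvd h9).resolve_left hs

/-- §4e (iii), DEGREE `8` (after (ii): `B′ = 9B₁`; `v₃(σ₄) = 2`, `v₃(σ₃) ≥ 2`, `v₃(σ₂) ≥ 1`, `D = 3D′`): on a monomial
`h_J`, `J` four regular slots (where `D′^{[4]}` has coefficient `1`), the coefficient of
`(e^{−B′}w)₈ = σ₄D^{[4]} − B′σ₃D^{[3]} + B′^{[2]}σ₂D^{[2]} + B′^{[4]}σ₀` is `81σ₄ + 243σ₃·a + 729σ₂·b + 6561σ₀·c`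
(`a, b, c ∈ ℤ` the `h_J`-coefficients of `∓B₁D′^{[3]}`, `B₁^{[2]}D′^{[2]}`, `B₁^{[4]}`), of `3`-adic valuation
EXACTLY `6 < 7`: the design condition `∈ 3⁷ ∧⁸Λ′^∨` fails — LEMMA SIX-EIGHT. -/
theorem degree_eight_coeff {σ₀ σ₂ σ₃ σ₄ a b c : ℤ} (h4 : 9 ∣ σ₄) (h4' : ¬ 27 ∣ σ₄) (h3 : 9 ∣ σ₃) (h2 : 3 ∣ σ₂) :
    ¬ 3 ^ 7 ∣ 81 * σ₄ + 243 * (σ₃ * a) + 729 * (σ₂ * b) + 6561 * (σ₀ * c) := by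
  have hX : 9 ∣ σ₃ * a := dvd_mul_of_dvd_left h3 a
  have hY : 3 ∣ σ₂ * b := dvd_mul_of_dvd_left h2 b
  generalize σ₃ * a = X at hX ⊢
  generalize σ₂ * b = Y at hY ⊢
  generalize σ₀ * c = Z
  omega

end Summit.Ventures.HSemireg.DualSieveDegreeSixKernel
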